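import Mathlib.NumberTheory.LSeries.PrimesInAP
import Literature.Analysis.Complex.LogDerivZeros
import Literature.NumberTheory.LFunctions.SiegelAbelSummation
import Literature.NumberTheory.LFunctions.ZetaClassicalRegionBounds
import Literature.NumberTheory.LFunctions.PerronTruncated
import HarnessLib

/-!
# Dirichlet `L`-functions near `σ = 1`: the inputs of the zero-free region (MV §11.1)

Topic `Literature/NumberTheory/LFunctions`. Everything in this file is PROVED (theorems only).

For a non-principal Dirichlet character `χ` modulo `q` we collect, with constants that are
*absolute* (independent of `q`, `χ`, `t`), the analytic inputs of Montgomery–Vaughan's proof of the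
zero-free region for `L(s, χ)` (*Multiplicative Number Theory I*, §11.1, Lemmas 11.1–11.2):

* `neg_logDeriv_LFunction_eq` — `−L'/L(s, χ) = ∑ χ(n)Λ(n) n^{-s}` on `σ > 1` (Mathlib), and the
  crude bound `‖L'/L(s, χ)‖ ≤ ∑ Λ(n) n^{-σ} ≤ 1/(σ−1) + K₀` (MV p. 277, proof of Thm. 11.4);
* `norm_LFunction_le_of_re_ge` — `‖L(s, χ)‖ ≤ q ‖s‖ Z` for `σ ≥ 1/4`, `Z = ∑ n^{-5/4}` (crude
  MV Lemma 10.15, from `|∑_{n ≤ x} χ(n)| ≤ q` by partial summation, `SiegelAbelSummation.lean`);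
* `norm_LFunction_ge` — `‖L(s, χ)‖ ≥ (σ−1)/σ` for `σ > 1` (from `L(s,χ) · ∑ μ(n)χ(n)n^{-s} = 1`;
  replaces "`|f(0)| ≫ 1` by the Euler product" in the proof of MV Lemma 11.1);
* `exists_logDeriv_package` — **MV Lemma 11.1** (approximate partial fraction of `L'/L`): on the
  discs `|z − (17/16 + it)| ≤ 13/128`,
  `L'/L(z, χ) = ∑_{ρ} m(ρ)/(z − ρ) + O(log q + log(|t| + 4))`, the sum over the zeros `ρ` with
  `|ρ − (17/16 + it)| ≤ 13/32`, via Titchmarsh's Lemma α (`Literature.Analysis.Complex.titchmarsh_logDeriv_sub_sum`);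
* `three_four_one`, `three_four_one_quadratic`, `one_add_re_nonneg` — **MV Lemma 11.2** and
  (11.4): `3(−ζ'/ζ(σ)) + 4 Re(−L'/L(σ+it, χ)) + Re(−L'/L(σ+2it, χ²)) ≥ 0` (for quadratic `χ`
  also with `ζ(σ + 2it)` as third function), and `−ζ'/ζ(σ) − Re L'/L(σ, χ) ≥ 0`;
* `re_neg_logDeriv_zeta_le` — `−Re ζ'/ζ(s) ≤ Re 1/(s−1) + C log(|t|+4)` for `1 < σ ≤ 2` (the tree's
  de la Vallée-Poussin bound `ζ₁'/ζ₁ ≪ log τ`, `Literature.NumberTheory.LFunctions.classicalZFRData_riemannZeta`).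

Throughout `log q + log(|t| + 4)` plays the role of MV's `log qτ`.

## References

* H. L. Montgomery, R. C. Vaughan, *Multiplicative Number Theory I. Classical Theory*, Cambridge
  Stud. Adv. Math. 97 (2007), §11.1: Lemma 11.1, Lemma 11.2, p. 277 (`MontgomeryVaughan2007`).
* E. C. Titchmarsh, *The Theory of the Riemann Zeta-Function*, 2nd ed. (1986), §3.9 Lemma α
  (`Titchmarsh1986`).
-/

noncomputable section

open Complex Filter Topology Metric Set Finset
open scoped LSeries.notation ArithmeticFunction.vonMangoldt ArithmeticFunction.Moebius

namespace Literature.NumberTheory.LFunctions.DirichletZFR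

/-! ## The quantity `log q + log(|t| + 4)` -/

/-- `1 ≤ log q + log(|t| + 4)` (`log q ≥ 0`, `log(|t|+4) ≥ log 4 > 1`). [folklore] -/
theorem one_le_ell (q : ℕ) (t : ℝ) : 1 ≤ Real.log q + Real.log (|t| + 4) := by
  have h1 := ClassicalZFRData.one_le_log_tau t
  have h2 : 0 ≤ Real.log q := Real.log_natCast_nonneg q
  linarith

/-- `0 < log q + log(|t| + 4)`. [folklore] -/
theorem ell_pos (q : ℕ) (t : ℝ) : 0 < Real.log q + Real.log (|t| + 4) :=
  one_pos.trans_le (one_le_ell q t)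

/-- `log(|t| + 4) ≤ log q + log(|t| + 4)`. [folklore] -/
theorem log_tau_le_ell (q : ℕ) (t : ℝ) :
    Real.log (|t| + 4) ≤ Real.log q + Real.log (|t| + 4) := by
  have h2 : 0 ≤ Real.log q := Real.log_natCast_nonneg q
  linarith

/-- Doubling the ordinate: `log q + log(|2t| + 4) ≤ 2 (log q + log(|t| + 4))`. [folklore] -/
theorem ell_two_mul_le (q : ℕ) (t : ℝ) :
    Real.log q + Real.log (|2 * t| + 4) ≤ 2 * (Real.log q + Real.log (|t| + 4)) := by
  have h2 : 0 ≤ Real.log q := Real.log_natCast_nonneg q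
  have h3 : Real.log (|2 * t| + 4) ≤ 2 * Real.log (|t| + 4) := by
    calc Real.log (|2 * t| + 4) ≤ Real.log (2 * (|t| + 4)) := by
          rw [abs_mul, abs_two]
          exact Real.log_le_log (by positivity) (by linarith [abs_nonneg t])
      _ ≤ 2 * Real.log (|t| + 4) := ClassicalZFRData.log_two_mul_tau_le t
  linarith

/-- Nearby ordinates: if `|t'| ≤ |t| + 1` then `log(|t'| + 4) ≤ (5/4) log(|t| + 4)`
(`log(|t|+5) ≤ log(|t|+4) + 1/4 ≤ (5/4) log(|t|+4)`). [folklore] -/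
theorem log_tau_le_of_abs_le {t t' : ℝ} (h : |t'| ≤ |t| + 1) :
    Real.log (|t'| + 4) ≤ 5 / 4 * Real.log (|t| + 4) := by
  have h0 : 0 < |t| + 4 := by positivity
  have h1 : Real.log (|t'| + 4) ≤ Real.log (|t| + 4) + 1 / 4 := by
    have hx : 0 < 1 + 1 / (|t| + 4) := by positivity
    calc Real.log (|t'| + 4) ≤ Real.log ((|t| + 4) * (1 + 1 / (|t| + 4))) := by
          refine Real.log_le_log (by positivity) ?_
          rw [mul_add, mul_one, mul_one_div_cancel h0.ne']
          linarith
      _ = Real.log (|t| + 4) + Real.log (1 + 1 / (|t| + 4)) :=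
          Real.log_mul h0.ne' hx.ne'
      _ ≤ Real.log (|t| + 4) + 1 / (|t| + 4) := by
          have := Real.log_le_sub_one_of_pos hx
          linarith
      _ ≤ Real.log (|t| + 4) + 1 / 4 := by
          gcongr
          linarith [abs_nonneg t]
  have h2 := ClassicalZFRData.one_le_log_tau t
  linarith

/-- Nearby ordinates for `log q + log(|t| + 4)`: if `|t'| ≤ |t| + 1` then
`log q + log(|t'| + 4) ≤ (5/4)(log q + log(|t| + 4))`. [folklore] -/
theorem ell_le_of_abs_le (q : ℕ) {t t' : ℝ} (h : |t'| ≤ |t| + 1) :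
    Real.log q + Real.log (|t'| + 4) ≤ 5 / 4 * (Real.log q + Real.log (|t| + 4)) := by
  have h1 := log_tau_le_of_abs_le h
  have h2 : 0 ≤ Real.log q := Real.log_natCast_nonneg q
  linarith

/-! ## `−L'/L(s, χ)` as a Dirichlet series, and the crude bound to the right of `σ = 1` -/

section LSeriesFacts

variable {q : ℕ} [NeZero q] (χ : DirichletCharacter ℂ q)

/-- **MV (4.25)**: `−L'/L(s, χ) = ∑ χ(n) Λ(n) n^{-s}` for `σ > 1` (Mathlib's
`DirichletCharacter.LSeries_twist_vonMangoldt_eq`, transported to `LFunction`).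
[cite: MontgomeryVaughan2007, §11.1 Lemma 11.2 (proof)] -/
theorem neg_logDeriv_LFunction_eq {s : ℂ} (hs : 1 < s.re) :
    -(deriv χ.LFunction s / χ.LFunction s) = L (↗χ * ↗Λ) s := by
  rw [DirichletCharacter.LSeries_twist_vonMangoldt_eq χ hs,
    DirichletCharacter.deriv_LFunction_eq_deriv_LSeries χ hs,
    DirichletCharacter.LFunction_eq_LSeries χ hs, neg_div]

omit [NeZero q] in
/-- The terms of `∑ χ(n)Λ(n) n^{-s}` are dominated by those of `∑ Λ(n) n^{-σ}`:
`‖χ(n)Λ(n) n^{-s}‖ ≤ Λ(n) n^{-σ}`. [folklore] -/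
theorem norm_term_twist_le (s : ℂ) (n : ℕ) :
    ‖LSeries.term (↗χ * ↗Λ) s n‖ ≤ Λ n / (n : ℝ) ^ s.re := by
  rcases eq_or_ne n 0 with rfl | hn
  · simp
  rw [LSeries.norm_term_eq, if_neg hn]
  have hΛ : 0 ≤ Λ n := ArithmeticFunction.vonMangoldt_nonneg
  have h1 : ‖(↗χ * ↗Λ) n‖ ≤ Λ n := by
    simp only [Pi.mul_apply, norm_mul, Complex.norm_real, Real.norm_of_nonneg hΛ]
    calc ‖χ (n : ZMod q)‖ * Λ n ≤ 1 * Λ n := by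
          gcongr; exact DirichletCharacter.norm_le_one χ _
      _ = Λ n := one_mul _
  exact div_le_div_of_nonneg_right h1 (by positivity)

omit [NeZero q] in
/-- For real `σ > 1`: `∑ Λ(n)/n^σ` converges and `‖∑ χ(n)Λ(n)n^{-s}‖ ≤ ∑ Λ(n) n^{-σ}`,
`σ = Re s`. [cite: MontgomeryVaughan2007, p. 277 (proof of Theorem 11.4)] -/
theorem norm_LSeries_twist_le {s : ℂ} (hs : 1 < s.re) :
    Summable (fun n : ℕ ↦ Λ n / (n : ℝ) ^ s.re) ∧
      ‖L (↗χ * ↗Λ) s‖ ≤ ∑' n : ℕ, Λ n / (n : ℝ) ^ s.re := by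
  have hσ0 : 0 < s.re := by linarith
  have hsumC : Summable (LSeries.term (fun n ↦ (Λ n : ℂ)) (s.re : ℂ)) :=
    ArithmeticFunction.LSeriesSummable_vonMangoldt (by simp [hs])
  have hterm : LSeries.term (fun n ↦ (Λ n : ℂ)) (s.re : ℂ) =
      fun n ↦ ((Λ n / (n : ℝ) ^ s.re : ℝ) : ℂ) :=
    funext (Literature.NumberTheory.LFunctions.term_vonMangoldt_ofReal hσ0)
  rw [hterm] at hsumC
  have hsumR : Summable (fun n : ℕ ↦ Λ n / (n : ℝ) ^ s.re) := Complex.summable_ofReal.1 hsumC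
  refine ⟨hsumR, ?_⟩
  have hs' : Summable fun n ↦ ‖LSeries.term (↗χ * ↗Λ) s n‖ :=
    Summable.of_nonneg_of_le (fun _ ↦ norm_nonneg _) (norm_term_twist_le χ s) hsumR
  calc ‖L (↗χ * ↗Λ) s‖ ≤ ∑' n, ‖LSeries.term (↗χ * ↗Λ) s n‖ := norm_tsum_le_tsum_norm hs'
    _ ≤ ∑' n : ℕ, Λ n / (n : ℝ) ^ s.re :=
        Summable.tsum_le_tsum (norm_term_twist_le χ s) hs' hsumR

omit [NeZero q] in
/-- `∑ Λ(n)/n^σ` is non-increasing in `σ > 1`. [folklore] -/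
theorem tsum_vonMangoldt_div_rpow_anti {σ σ' : ℝ} (hσ : 1 < σ) (hσσ' : σ ≤ σ') :
    ∑' n : ℕ, Λ n / (n : ℝ) ^ σ' ≤ ∑' n : ℕ, Λ n / (n : ℝ) ^ σ := by
  have hsum : ∀ u : ℝ, 1 < u → Summable (fun n : ℕ ↦ Λ n / (n : ℝ) ^ u) := by
    intro u hu
    have hsumC : Summable (LSeries.term (fun n ↦ (Λ n : ℂ)) (u : ℂ)) :=
      ArithmeticFunction.LSeriesSummable_vonMangoldt (by simp [hu])
    have hterm : LSeries.term (fun n ↦ (Λ n : ℂ)) (u : ℂ) =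
        fun n ↦ ((Λ n / (n : ℝ) ^ u : ℝ) : ℂ) :=
      funext (Literature.NumberTheory.LFunctions.term_vonMangoldt_ofReal (by linarith))
    rw [hterm] at hsumC
    exact Complex.summable_ofReal.1 hsumC
  refine Summable.tsum_le_tsum (fun n ↦ ?_) (hsum σ' (by linarith)) (hsum σ hσ)
  rcases eq_or_ne n 0 with rfl | hn
  · simp
  have hΛ : 0 ≤ Λ n := ArithmeticFunction.vonMangoldt_nonneg
  have hn1 : (1 : ℝ) ≤ n := by exact_mod_cast Nat.one_le_iff_ne_zero.2 hn
  exact div_le_div_of_nonneg_left hΛ (by positivity)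
    (Real.rpow_le_rpow_of_exponent_le hn1 hσσ')

/-- **`−ζ'/ζ(σ) ≤ 1/(σ−1) + K₀`, and hence `‖L'/L(s, χ)‖ ≤ 1/(σ−1) + K₀` for `1 < σ ≤ 2`,
`‖L'/L(s, χ)‖ ≤ 1 + K₀` for `σ ≥ 2`** (MV p. 277: "`|L'/L(s,χ)| ≤ ∑ Λ(n)n^{-σ} = −ζ'/ζ(σ) ≪
1/(σ−1)`"), with one absolute constant `K₀`. [cite: MontgomeryVaughan2007, p. 277 (proof of Theorem 11.4)] -/
theorem exists_norm_logDeriv_le :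
    ∃ K₀ : ℝ, 0 ≤ K₀ ∧
      (∀ σ : ℝ, 1 < σ → σ ≤ 2 → Summable (fun n : ℕ ↦ Λ n / (n : ℝ) ^ σ) ∧
        ∑' n : ℕ, Λ n / (n : ℝ) ^ σ ≤ 1 / (σ - 1) + K₀) ∧
      ∀ (q : ℕ) [NeZero q] (χ : DirichletCharacter ℂ q) (s : ℂ), 1 < s.re →
        ‖deriv χ.LFunction s / χ.LFunction s‖ ≤ 1 / (min s.re 2 - 1) + K₀ := by
  obtain ⟨K₀, hK₀, hK⟩ := Literature.NumberTheory.LFunctions.exists_tsum_vonMangoldt_div_rpow_le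
  refine ⟨K₀, hK₀, hK, fun q _ χ s hs ↦ ?_⟩
  rw [← norm_neg, neg_logDeriv_LFunction_eq χ hs]
  refine (norm_LSeries_twist_le χ hs).2.trans ?_
  rcases le_or_gt s.re 2 with h2 | h2
  · rw [min_eq_left h2]
    exact (hK s.re hs h2).2
  · rw [min_eq_right h2.le]
    calc ∑' n : ℕ, Λ n / (n : ℝ) ^ s.re ≤ ∑' n : ℕ, Λ n / (n : ℝ) ^ (2 : ℝ) :=
          tsum_vonMangoldt_div_rpow_anti (by norm_num) h2.le
      _ ≤ 1 / (2 - 1) + K₀ := (hK 2 (by norm_num) le_rfl).2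

/-- The real Dirichlet series `L(Λ, σ) = ∑ Λ(n) n^{-σ}` for real `σ > 1`: its value is the real
number `∑ Λ(n)/n^σ`. [folklore] -/
theorem LSeries_vonMangoldt_ofReal {σ : ℝ} (hσ : 1 < σ) :
    L ↗Λ (σ : ℂ) = ((∑' n : ℕ, Λ n / (n : ℝ) ^ σ : ℝ) : ℂ) := by
  have hterm : LSeries.term (fun n ↦ (Λ n : ℂ)) (σ : ℂ) =
      fun n ↦ ((Λ n / (n : ℝ) ^ σ : ℝ) : ℂ) :=
    funext (Literature.NumberTheory.LFunctions.term_vonMangoldt_ofReal (by linarith))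
  rw [ofReal_tsum, LSeries, show (↗Λ : ℕ → ℂ) = fun n ↦ (Λ n : ℂ) from rfl, hterm]

end LSeriesFacts

/-! ## Upper and lower bounds for `L(s, χ)` -/

section Bounds

variable {q : ℕ} [NeZero q] (χ : DirichletCharacter ℂ q)

/-- **Crude MV Lemma 10.15**: for `χ ≠ 1` and `σ = Re s ≥ 1/4`,
`‖L(s, χ)‖ ≤ q ‖s‖ Z` with the absolute constant `Z = ∑_{n ≥ 1} n^{-5/4}`.
[cite: MontgomeryVaughan2007, §10.2 Lemma 10.15] -/
theorem norm_LFunction_le_of_re_ge (hχ : χ ≠ 1) {s : ℂ} (hs : 1 / 4 ≤ s.re) :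
    ‖χ.LFunction s‖ ≤ q * ‖s‖ * ∑' n : ℕ, ((n + 1 : ℕ) : ℝ) ^ (-(5 / 4 : ℝ)) := by
  have hs0 : 0 < s.re := by linarith
  refine (DirichletAbel.norm_LFunction_le χ hχ hs0).trans ?_
  have hZ : Summable fun n : ℕ ↦ ((n + 1 : ℕ) : ℝ) ^ (-(5 / 4 : ℝ)) := by
    have := DirichletAbel.summable_rpow_neg (σ := 1 / 4) (by norm_num)
    convert this using 2; norm_num
  refine mul_le_mul_of_nonneg_left ?_ (by positivity)
  refine Summable.tsum_le_tsum (fun n ↦ ?_) (DirichletAbel.summable_rpow_neg hs0) hZ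
  have h1 : (1 : ℝ) ≤ ((n + 1 : ℕ) : ℝ) := by exact_mod_cast Nat.le_add_left 1 n
  exact Real.rpow_le_rpow_of_exponent_le h1 (by linarith)

/-- The absolute constant `Z = ∑_{n ≥ 1} n^{-5/4}` is at least `1` (its first term).
[folklore] -/
theorem one_le_tsum_rpow : (1 : ℝ) ≤ ∑' n : ℕ, ((n + 1 : ℕ) : ℝ) ^ (-(5 / 4 : ℝ)) := by
  have hsum : Summable fun n : ℕ ↦ ((n + 1 : ℕ) : ℝ) ^ (-(5 / 4 : ℝ)) := by
    have := DirichletAbel.summable_rpow_neg (σ := 1 / 4) (by norm_num)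
    convert this using 2; norm_num
  calc (1 : ℝ) = ∑ n ∈ Finset.range 1, ((n + 1 : ℕ) : ℝ) ^ (-(5 / 4 : ℝ)) := by simp
    _ ≤ ∑' n : ℕ, ((n + 1 : ℕ) : ℝ) ^ (-(5 / 4 : ℝ)) :=
        hsum.sum_le_tsum _ (fun n _ ↦ by positivity)

/-- **Lower bound to the right of `σ = 1`**: `‖L(s, χ)‖ ≥ (σ − 1)/σ` for `σ = Re s > 1`, since
`L(s, χ) · ∑ χ(n)μ(n) n^{-s} = 1` (Mathlib) and `‖∑ χ(n)μ(n)n^{-s}‖ ≤ ζ(σ) ≤ σ/(σ−1)`. (MV prove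
`|L(3/2 + it, χ)| ≫ 1` from the Euler product, Lemma 11.1.) [cite: MontgomeryVaughan2007, Lemma 11.1 (proof)] -/
theorem norm_LFunction_ge {s : ℂ} (hs : 1 < s.re) : (s.re - 1) / s.re ≤ ‖χ.LFunction s‖ := by
  have hmul := DirichletCharacter.LSeries.mul_mu_eq_one χ hs
  rw [← DirichletCharacter.LFunction_eq_LSeries χ hs] at hmul
  have hM : ‖L (↗χ * ↗μ) s‖ ≤ s.re / (s.re - 1) := by
    refine ZetaClassicalRegion.norm_LSeries_le_of_norm_le_one (fun n ↦ ?_) hs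
    simp only [Pi.mul_apply, norm_mul]
    calc ‖χ (n : ZMod q)‖ * ‖(μ n : ℂ)‖ ≤ 1 * 1 := by
          gcongr
          · exact DirichletCharacter.norm_le_one χ _
          · rw [Complex.norm_intCast]; exact_mod_cast ArithmeticFunction.abs_moebius_le_one
      _ = 1 := one_mul _
  have hσ0 : 0 < s.re := by linarith
  have hσ1 : 0 < s.re - 1 := by linarith
  have hne : χ.LFunction s ≠ 0 := fun h ↦ by simp [h] at hmul
  have hpos : 0 < ‖χ.LFunction s‖ := norm_pos_iff.2 hne
  have h1 : 1 ≤ ‖χ.LFunction s‖ * (s.re / (s.re - 1)) := by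
    calc (1 : ℝ) = ‖χ.LFunction s * L (↗χ * ↗μ) s‖ := by rw [hmul, norm_one]
      _ = ‖χ.LFunction s‖ * ‖L (↗χ * ↗μ) s‖ := norm_mul _ _
      _ ≤ ‖χ.LFunction s‖ * (s.re / (s.re - 1)) := by gcongr
  rw [div_le_iff₀ hσ0]
  rw [mul_div_assoc', le_div_iff₀ hσ1] at h1
  linarith

end Bounds


/-! ## MV Lemma 11.1: the approximate partial fraction of `L'/L` (Titchmarsh's Lemma α) -/

/-- **Montgomery–Vaughan Lemma 11.1** (non-principal case), in the form produced by Titchmarsh's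
Lemma α (`Literature.Analysis.Complex.titchmarsh_logDeriv_sub_sum`) on the discs centred at `c = 17/16 + it` with
`R = 13/32`: there is an absolute constant `E` such that for every `q`, every non-principal `χ`
mod `q` and every real `t`, the zeros of `L(s, χ)` in `|a − c| ≤ 13/32` form a finite set `S`
with multiplicities `m ≥ 1`, and `L'/L(z, χ) = ∑_{a ∈ S} m(a)/(z − a) + ψ(z)` on `|z − c| < 13/32`
(off the zeros) with `|ψ(z)| ≤ E (log q + log(|t| + 4))` for `|z − c| ≤ 13/128`. Inputs:
`|L(z, χ)| ≤ q(|t|+4) Z` on `|z − c| ≤ 13/16` (`norm_LFunction_le_of_re_ge`) and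
`|L(c, χ)| ≥ 1/17` (`norm_LFunction_ge`), so that `log(M/|L(c,χ)|) ≤ log(17 Z) + log q + log(|t|+4)`.
[cite: MontgomeryVaughan2007, Lemma 11.1] -/
theorem exists_logDeriv_package :
    ∃ E : ℝ, 0 ≤ E ∧ ∀ (q : ℕ) [NeZero q] (χ : DirichletCharacter ℂ q), χ ≠ 1 → ∀ t : ℝ,
      ∃ (S : Finset ℂ) (m : ℂ → ℕ) (ψ : ℂ → ℂ),
        (∀ a ∈ S, χ.LFunction a = 0 ∧ 0 < m a ∧ ‖a - (17 / 16 + t * I)‖ ≤ 13 / 32) ∧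
        (∀ a, χ.LFunction a = 0 → ‖a - (17 / 16 + t * I)‖ ≤ 13 / 32 → a ∈ S) ∧
        (∀ z ∈ ball (17 / 16 + t * I) (13 / 32), χ.LFunction z ≠ 0 →
          ψ z = deriv χ.LFunction z / χ.LFunction z - ∑ a ∈ S, (m a : ℂ) / (z - a)) ∧
        (∀ z ∈ closedBall (17 / 16 + t * I) (13 / 128),
          ‖ψ z‖ ≤ E * (Real.log q + Real.log (|t| + 4))) := by
  set Z : ℝ := ∑' n : ℕ, ((n + 1 : ℕ) : ℝ) ^ (-(5 / 4 : ℝ)) with hZ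
  have hZ1 : 1 ≤ Z := one_le_tsum_rpow
  have hE₀ : 0 ≤ Real.log (17 * Z) := Real.log_nonneg (by linarith)
  set R : ℝ := 13 / 32 with hR
  have hRpos : 0 < R := by norm_num
  refine ⟨8 * (Real.log (17 * Z) + 2) / R, by positivity, fun q _ χ hχ t ↦ ?_⟩
  set c : ℂ := 17 / 16 + t * I with hcdef
  have hcre : c.re = 17 / 16 := by simp [hcdef]
  have hcim : c.im = t := by simp [hcdef]
  have hq : (1 : ℝ) ≤ q := by exact_mod_cast NeZero.one_le
  -- the bound `M` on the disc `|z - c| ≤ 2R = 13/16`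
  set M : ℝ := q * (|t| + 4) * Z with hMdef
  have hM : ∀ z ∈ closedBall c (2 * R), ‖χ.LFunction z‖ ≤ M := by
    intro z hz
    rw [mem_closedBall, dist_eq_norm] at hz
    have hre : |(z - c).re| ≤ ‖z - c‖ := Complex.abs_re_le_norm _
    have him : |(z - c).im| ≤ ‖z - c‖ := Complex.abs_im_le_norm _
    simp only [Complex.sub_re, hcre, Complex.sub_im, hcim] at hre him
    have hzre : 1 / 4 ≤ z.re := by
      have := neg_abs_le (z.re - 17 / 16)
      rw [hR] at hz; linarith
    have hzn : ‖z‖ ≤ |t| + 4 := by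
      have h1 := Complex.norm_le_abs_re_add_abs_im z
      have h2 : |z.re| ≤ 17 / 16 + 13 / 16 := by
        have h2a := le_abs_self (z.re - 17 / 16)
        have h2b := neg_abs_le (z.re - 17 / 16)
        rw [hR] at hz
        rw [abs_le]; constructor <;> linarith
      have h3 : |z.im| ≤ |t| + 13 / 16 := by
        have := abs_sub_abs_le_abs_sub z.im t
        rw [hR] at hz; linarith
      linarith
    calc ‖χ.LFunction z‖ ≤ q * ‖z‖ * Z := norm_LFunction_le_of_re_ge χ hχ hzre
      _ ≤ q * (|t| + 4) * Z := by gcongr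
  -- the lower bound at the centre
  have hc1 : 1 < c.re := by rw [hcre]; norm_num
  have hlow : 1 / 17 ≤ ‖χ.LFunction c‖ := by
    have := norm_LFunction_ge χ hc1
    rw [hcre] at this
    norm_num at this
    exact this
  have hc0 : χ.LFunction c ≠ 0 := by
    intro h; rw [h, norm_zero] at hlow; norm_num at hlow
  obtain ⟨S, m, ψ, hS, hS', -, hψ, hψb, -⟩ :=
    Literature.Analysis.Complex.titchmarsh_logDeriv_sub_sum (DirichletCharacter.differentiable_LFunction hχ) hc0
      hRpos hM
  refine ⟨S, m, ψ, hS, hS', hψ, fun z hz ↦ (hψb z (by rw [hR]; convert hz using 2; norm_num)).trans ?_⟩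
  -- `log(M/‖L(c)‖) ≤ log(17 Z) + log q + log(|t| + 4)`
  have hMpos : 0 < M := by positivity
  have hℓ := one_le_ell q t
  have hlog : Real.log (M / ‖χ.LFunction c‖) ≤
      Real.log (17 * Z) + (Real.log q + Real.log (|t| + 4)) := by
    have hpos : 0 < ‖χ.LFunction c‖ := by linarith
    have h1 : M / ‖χ.LFunction c‖ ≤ 17 * M := by
      rw [div_le_iff₀ hpos]; nlinarith
    calc Real.log (M / ‖χ.LFunction c‖) ≤ Real.log (17 * M) :=
          Real.log_le_log (by positivity) h1
      _ = Real.log (17 * Z) + (Real.log q + Real.log (|t| + 4)) := by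
          rw [hMdef, show (17 : ℝ) * (q * (|t| + 4) * Z) = (17 * Z) * q * (|t| + 4) by ring,
            Real.log_mul (by positivity) (by positivity), Real.log_mul (by positivity) (by positivity)]
          ring
  rw [div_mul_eq_mul_div, hR]
  rw [div_le_div_iff_of_pos_right (by norm_num : (0:ℝ) < 13 / 32)]
  have : Real.log (17 * Z) ≤ Real.log (17 * Z) * (Real.log q + Real.log (|t| + 4)) := by
    nlinarith
  nlinarith


/-! ## MV Lemma 11.2: positivity (`3 + 4 cos θ + cos 2θ ≥ 0`) -/

/-- `3 + 4 Re w + Re w² ≥ 0` for `|w| ≤ 1`: with `w = x + iy`,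
`3 + 4x + x² − y² = 2(1 + x)² + (1 − x² − y²)`. (For `|w| = 1` this is MV's
`3 + 4 cos θ + cos 2θ = 2(1 + cos θ)² ≥ 0`.) [cite: MontgomeryVaughan2007, Lemma 11.2] -/
theorem three_four_one_re_nonneg {w : ℂ} (hw : ‖w‖ ≤ 1) : 0 ≤ 3 + 4 * w.re + (w ^ 2).re := by
  have h1 : w.re ^ 2 + w.im ^ 2 ≤ 1 := by
    have h := Complex.normSq_eq_norm_sq w
    rw [Complex.normSq_apply] at h
    nlinarith [norm_nonneg w]
  have h2 : (w ^ 2).re = w.re ^ 2 - w.im ^ 2 := by rw [sq, Complex.mul_re]; ring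
  rw [h2]
  nlinarith [sq_nonneg (1 + w.re)]

/-- `3 + Re v ≥ 0` for `|v| ≤ 1`. [folklore] -/
theorem three_add_re_nonneg {v : ℂ} (hv : ‖v‖ ≤ 1) : 0 ≤ 3 + v.re := by
  have := (Complex.abs_re_le_norm v).trans hv
  linarith [neg_abs_le v.re]

section Positivity

variable {q : ℕ} (χ : DirichletCharacter ℂ q)

/-- The terms of a twisted von Mangoldt series at `s = σ + it`:
`(f Λ)(n) n^{-s} = (Λ(n) n^{-σ}) · (f(n) n^{-it})` for `n ≥ 1`. [folklore] -/
theorem term_twist_eq (f : ℕ → ℂ) (σ t : ℝ) {n : ℕ} (hn : n ≠ 0) :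
    LSeries.term (f * ↗Λ) (σ + t * I) n =
      ((Λ n / (n : ℝ) ^ σ : ℝ) : ℂ) * (f n * (n : ℂ) ^ (-(t * I))) := by
  have hn0 : (n : ℂ) ≠ 0 := Nat.cast_ne_zero.2 hn
  rw [LSeries.term_of_ne_zero hn, Pi.mul_apply, Complex.cpow_add _ _ hn0, Complex.cpow_neg,
    Complex.ofReal_div, Complex.ofReal_cpow (Nat.cast_nonneg n)]
  have h1 : (n : ℂ) ^ (σ : ℂ) ≠ 0 := by
    rw [Ne, Complex.cpow_eq_zero_iff]; exact fun h ↦ hn0 h.1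
  have h2 : (n : ℂ) ^ ((t : ℂ) * I) ≠ 0 := by
    rw [Ne, Complex.cpow_eq_zero_iff]; exact fun h ↦ hn0 h.1
  push_cast
  field_simp

/-- `|f(n) n^{-it}| ≤ 1` when `|f(n)| ≤ 1` (`n ≥ 1`). [folklore] -/
theorem norm_mul_cpow_neg_le {f : ℕ → ℂ} (hf : ∀ n, ‖f n‖ ≤ 1) (t : ℝ) {n : ℕ} (hn : n ≠ 0) :
    ‖f n * (n : ℂ) ^ (-(t * I))‖ ≤ 1 := by
  rw [norm_mul, Complex.norm_natCast_cpow_of_pos (Nat.pos_of_ne_zero hn)]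
  simp only [Complex.neg_re, Complex.mul_re, Complex.ofReal_re, Complex.I_re, mul_zero,
    Complex.ofReal_im, Complex.I_im, mul_one, sub_self, neg_zero, Real.rpow_zero, mul_one]
  exact hf n

/-- **Montgomery–Vaughan Lemma 11.2** (with `ζ` in place of `L(·, χ₀)` as first function, which
only adds non-negative terms): for `σ > 1`, real `t` and any Dirichlet character `χ` mod `q`,
`3 L(Λ, σ) + 4 Re L(χΛ, σ + it) + Re L(χ²Λ, σ + 2it) ≥ 0`, i.e.
`Re(−3 ζ'/ζ(σ) − 4 L'/L(σ+it, χ) − L'/L(σ+2it, χ²)) ≥ 0`, because the `n`-th term is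
`Λ(n) n^{-σ} (3 + 4 Re w + Re w²)` with `w = χ(n) n^{-it}`, `|w| ≤ 1`.
[cite: MontgomeryVaughan2007, Lemma 11.2] -/
theorem three_four_one {σ : ℝ} (hσ : 1 < σ) (t : ℝ) :
    0 ≤ 3 * (L ↗Λ (σ : ℂ)).re + 4 * (L (↗χ * ↗Λ) (σ + t * I)).re +
      (L (↗(χ ^ 2) * ↗Λ) (σ + (2 * t) * I)).re := by
  have hs1 : 1 < (σ : ℂ).re := by simp [hσ]
  have hs2 : 1 < ((σ : ℂ) + t * I).re := by simp [hσ]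
  have hs3 : 1 < ((σ : ℂ) + (2 * t) * I).re := by simp [hσ]
  have hA := (ArithmeticFunction.LSeriesSummable_vonMangoldt hs1).hasSum
  have hB := (DirichletCharacter.LSeriesSummable_twist_vonMangoldt χ hs2).hasSum
  have hC := (DirichletCharacter.LSeriesSummable_twist_vonMangoldt (χ ^ 2) hs3).hasSum
  have hsum := ((hA.mul_left 3).add ((hB.mul_left 4).add hC)).mapL Complex.reCLM
  simp only [Complex.reCLM_apply] at hsum
  have hre : (3 * L ↗Λ ↑σ + (4 * L (↗χ * ↗Λ) (↑σ + ↑t * I) + L (↗(χ ^ 2) * ↗Λ) (↑σ + 2 * ↑t * I))).re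
      = 3 * (L ↗Λ (σ : ℂ)).re + 4 * (L (↗χ * ↗Λ) (σ + t * I)).re +
        (L (↗(χ ^ 2) * ↗Λ) (σ + (2 * t) * I)).re := by
    simp only [Complex.add_re, Complex.mul_re]; norm_num; ring
  rw [← hre]
  refine hsum.nonneg fun n ↦ ?_
  rcases eq_or_ne n 0 with rfl | hn
  · simp
  have hΛ : 0 ≤ Λ n / (n : ℝ) ^ σ := div_nonneg ArithmeticFunction.vonMangoldt_nonneg (by positivity)
  set w : ℂ := χ n * (n : ℂ) ^ (-(t * I)) with hw
  have hwn : ‖w‖ ≤ 1 := norm_mul_cpow_neg_le (fun k ↦ DirichletCharacter.norm_le_one χ _) t hn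
  have h2t : ((2 * t : ℝ) : ℂ) = 2 * (t : ℂ) := by push_cast; ring
  have hB' : LSeries.term (↗χ * ↗Λ) (σ + t * I) n = ((Λ n / (n : ℝ) ^ σ : ℝ) : ℂ) * w :=
    term_twist_eq _ σ t hn
  have hC' : LSeries.term (↗(χ ^ 2) * ↗Λ) (σ + 2 * t * I) n =
      ((Λ n / (n : ℝ) ^ σ : ℝ) : ℂ) * w ^ 2 := by
    have h := term_twist_eq (↗(χ ^ 2) : ℕ → ℂ) σ (2 * t) hn
    rw [h2t] at h
    rw [h]
    congr 1
    rw [hw, mul_pow, MulChar.pow_apply' χ two_ne_zero]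
    congr 1
    have hn0 : (n : ℂ) ≠ 0 := Nat.cast_ne_zero.2 hn
    rw [sq, ← Complex.cpow_add _ _ hn0]
    congr 1; ring
  rw [Literature.NumberTheory.LFunctions.term_vonMangoldt_ofReal (by linarith : 0 < σ) n, hB', hC']
  simp only [Complex.add_re, Complex.re_ofReal_mul]
  have key := three_four_one_re_nonneg hwn
  have : 0 ≤ Λ n / (n : ℝ) ^ σ * (3 + 4 * w.re + (w ^ 2).re) := mul_nonneg hΛ key
  norm_num
  nlinarith

/-- **MV Lemma 11.2, quadratic variant** (used in Case 2 of the proof of MV Theorem 11.3, where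
`χ² = χ₀`): for `χ² = 1`, `σ > 1` and real `t`,
`3 L(Λ, σ) + 4 Re L(χΛ, σ + it) + Re L(Λ, σ + 2it) ≥ 0`, i.e.
`Re(−3 ζ'/ζ(σ) − 4 L'/L(σ+it, χ) − ζ'/ζ(σ+2it)) ≥ 0`: the `n`-th term is
`Λ(n)n^{-σ}(3 + 4 Re w + Re w²) ≥ 0` (`w = χ(n)n^{-it}`, `χ(n) = ±1`) if `(n, q) = 1`, and
`Λ(n)n^{-σ}(3 + Re n^{-2it}) ≥ 0` otherwise. [cite: MontgomeryVaughan2007, Lemma 11.2] -/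
theorem three_four_one_quadratic (hχ : χ ^ 2 = 1) {σ : ℝ} (hσ : 1 < σ) (t : ℝ) :
    0 ≤ 3 * (L ↗Λ (σ : ℂ)).re + 4 * (L (↗χ * ↗Λ) (σ + t * I)).re +
      (L ↗Λ (σ + (2 * t) * I)).re := by
  have hs1 : 1 < (σ : ℂ).re := by simp [hσ]
  have hs2 : 1 < ((σ : ℂ) + t * I).re := by simp [hσ]
  have hs3 : 1 < ((σ : ℂ) + (2 * t) * I).re := by simp [hσ]
  have hA := (ArithmeticFunction.LSeriesSummable_vonMangoldt hs1).hasSum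
  have hB := (DirichletCharacter.LSeriesSummable_twist_vonMangoldt χ hs2).hasSum
  have hC := (ArithmeticFunction.LSeriesSummable_vonMangoldt hs3).hasSum
  have hsum := ((hA.mul_left 3).add ((hB.mul_left 4).add hC)).mapL Complex.reCLM
  simp only [Complex.reCLM_apply] at hsum
  have hre : (3 * L ↗Λ ↑σ + (4 * L (↗χ * ↗Λ) (↑σ + ↑t * I) + L ↗Λ (↑σ + 2 * ↑t * I))).re
      = 3 * (L ↗Λ (σ : ℂ)).re + 4 * (L (↗χ * ↗Λ) (σ + t * I)).re +
        (L ↗Λ (σ + (2 * t) * I)).re := by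
    simp only [Complex.add_re, Complex.mul_re]; norm_num; ring
  rw [← hre]
  refine hsum.nonneg fun n ↦ ?_
  rcases eq_or_ne n 0 with rfl | hn
  · simp
  have hn0 : (n : ℂ) ≠ 0 := Nat.cast_ne_zero.2 hn
  have hΛ : 0 ≤ Λ n / (n : ℝ) ^ σ := div_nonneg ArithmeticFunction.vonMangoldt_nonneg (by positivity)
  set v : ℂ := (n : ℂ) ^ (-(t * I)) with hv
  set w : ℂ := χ n * v with hw
  have hwn : ‖w‖ ≤ 1 := norm_mul_cpow_neg_le (fun k ↦ DirichletCharacter.norm_le_one χ _) t hn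
  have hvn : ‖v‖ ≤ 1 := by
    have := norm_mul_cpow_neg_le (f := fun _ ↦ (1 : ℂ)) (fun k ↦ by simp) t hn
    simpa [hv] using this
  have h2t : ((2 * t : ℝ) : ℂ) = 2 * (t : ℂ) := by push_cast; ring
  have hB' : LSeries.term (↗χ * ↗Λ) (σ + t * I) n = ((Λ n / (n : ℝ) ^ σ : ℝ) : ℂ) * w :=
    term_twist_eq _ σ t hn
  -- the third term, via `Λ = 1 · Λ`
  have hC' : LSeries.term ↗Λ (σ + 2 * t * I) n = ((Λ n / (n : ℝ) ^ σ : ℝ) : ℂ) * v ^ 2 := by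
    have h := term_twist_eq (fun _ ↦ (1 : ℂ)) σ (2 * t) hn
    rw [h2t] at h
    have h1 : ((fun _ ↦ (1 : ℂ)) * ↗Λ : ℕ → ℂ) = ↗Λ := by ext k; simp
    rw [h1] at h
    rw [h, one_mul, hv, sq, ← Complex.cpow_add _ _ hn0]
    congr 2; ring
  rw [Literature.NumberTheory.LFunctions.term_vonMangoldt_ofReal (by linarith : 0 < σ) n, hB', hC']
  simp only [Complex.add_re, Complex.re_ofReal_mul]
  -- `χ(n)² ∈ {0, 1}`
  have hχn : χ n ^ 2 = 1 ∨ χ n = 0 := by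
    by_cases hu : IsUnit (n : ZMod q)
    · left
      rw [← MulChar.pow_apply' χ two_ne_zero, hχ, MulChar.one_apply hu]
    · right; exact MulChar.map_nonunit χ hu
  have key : 0 ≤ 3 + 4 * w.re + (v ^ 2).re := by
    rcases hχn with h1 | h0
    · have : v ^ 2 = w ^ 2 := by rw [hw, mul_pow, h1, one_mul]
      rw [this]; exact three_four_one_re_nonneg hwn
    · have hw0 : w = 0 := by rw [hw, h0, zero_mul]
      rw [hw0, Complex.zero_re, mul_zero, add_zero]
      have hv2 : ‖v ^ 2‖ ≤ 1 := by rw [norm_pow]; exact pow_le_one₀ (norm_nonneg _) hvn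
      exact three_add_re_nonneg hv2
  have : 0 ≤ Λ n / (n : ℝ) ^ σ * (3 + 4 * w.re + (v ^ 2).re) := mul_nonneg hΛ key
  norm_num
  nlinarith

/-- **MV (11.4)**: for `σ > 1` and any character `χ` mod `q`,
`L(Λ, σ) + Re L(χΛ, σ) = ∑ Λ(n) n^{-σ} (1 + Re χ(n)) ≥ 0`, i.e. `−ζ'/ζ(σ) − Re L'/L(σ, χ) ≥ 0`.
[cite: MontgomeryVaughan2007, Theorem 11.3 (proof, eq. (11.4))] -/
theorem one_add_re_nonneg {σ : ℝ} (hσ : 1 < σ) :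
    0 ≤ (L ↗Λ (σ : ℂ)).re + (L (↗χ * ↗Λ) (σ : ℂ)).re := by
  have hs1 : 1 < (σ : ℂ).re := by simp [hσ]
  have hA := (ArithmeticFunction.LSeriesSummable_vonMangoldt hs1).hasSum
  have hB := (DirichletCharacter.LSeriesSummable_twist_vonMangoldt χ hs1).hasSum
  have hsum := (hA.add hB).mapL Complex.reCLM
  simp only [Complex.reCLM_apply] at hsum
  rw [← Complex.add_re]
  refine hsum.nonneg fun n ↦ ?_
  rcases eq_or_ne n 0 with rfl | hn
  · simp
  have hΛ : 0 ≤ Λ n / (n : ℝ) ^ σ := div_nonneg ArithmeticFunction.vonMangoldt_nonneg (by positivity)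
  have hB' : LSeries.term (↗χ * ↗Λ) (σ : ℂ) n = ((Λ n / (n : ℝ) ^ σ : ℝ) : ℂ) * χ n := by
    have h := term_twist_eq (↗χ : ℕ → ℂ) σ 0 hn
    simp only [Complex.ofReal_zero, zero_mul, add_zero, neg_zero, Complex.cpow_zero, mul_one] at h
    exact h
  rw [Literature.NumberTheory.LFunctions.term_vonMangoldt_ofReal (by linarith : 0 < σ) n, hB']
  simp only [Complex.add_re, Complex.ofReal_re, Complex.re_ofReal_mul]
  have h1 : -1 ≤ (χ n).re := by
    have := (Complex.abs_re_le_norm (χ n)).trans (DirichletCharacter.norm_le_one χ _)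
    linarith [neg_abs_le (χ n).re]
  nlinarith

end Positivity

/-! ## `ζ` near `σ = 1`: `−Re ζ'/ζ(s) ≤ Re 1/(s − 1) + C log(|t| + 4)` -/

/-- **de la Vallée-Poussin's bound for `ζ'/ζ` to the right of `σ = 1`** (MV Theorem 6.7 via the
tree's `Literature.NumberTheory.LFunctions.classicalZFRData_riemannZeta.norm_logDeriv_le`): there is an absolute `C ≥ 0` with
`−Re ζ'/ζ(s) ≤ Re (1/(s − 1)) + C log(|t| + 4)` and `‖ζ'/ζ(s) + 1/(s−1)‖ ≤ C log(|t| + 4)`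
for `1 < σ ≤ 2` (`ζ'/ζ = ζ₁'/ζ₁ − 1/(s − 1)`, `ζ₁'/ζ₁ ≪ log τ`). This is the replacement, for the
principal character, of the third inequality of MV (11.2) in Case 2 of Theorem 11.3.
[cite: MontgomeryVaughan2007, Theorem 6.7] -/
theorem exists_re_neg_logDeriv_zeta_le :
    ∃ C : ℝ, 0 ≤ C ∧ ∀ s : ℂ, 1 < s.re → s.re ≤ 2 →
      ‖deriv riemannZeta s / riemannZeta s + 1 / (s - 1)‖ ≤ C * Real.log (|s.im| + 4) ∧
      (-(deriv riemannZeta s / riemannZeta s)).re ≤ (1 / (s - 1)).re + C * Real.log (|s.im| + 4) := by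
  obtain ⟨c₀, hc₀, C₀, hC₀, hreg⟩ := Literature.NumberTheory.LFunctions.classicalZFRData_riemannZeta.norm_logDeriv_le
  refine ⟨C₀, hC₀, fun s hs1 hs2 ↦ ?_⟩
  have hs1' : s ≠ 1 := by
    intro h; rw [h] at hs1; simp at hs1
  have hζ : riemannZeta s ≠ 0 := riemannZeta_ne_zero_of_one_lt_re hs1
  have hreg' := hreg s (by linarith) (by
    have : 0 < c₀ / Real.log (|s.im| + 4) := div_pos hc₀ (ClassicalZFRData.log_tau_pos _)
    linarith)
  have hdecomp : deriv riemannZeta s / riemannZeta s =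
      deriv riemannZeta₁ s / riemannZeta₁ s - 1 / (s - 1) := by
    rw [← logDeriv_apply, ← logDeriv_apply, Literature.NumberTheory.LFunctions.logDeriv_riemannZeta_eq hs1' hζ, one_div]
  have h1 : ‖deriv riemannZeta s / riemannZeta s + 1 / (s - 1)‖ ≤ C₀ * Real.log (|s.im| + 4) := by
    rw [hdecomp, sub_add_cancel]; exact hreg'.2
  refine ⟨h1, ?_⟩
  have h2 : -(deriv riemannZeta s / riemannZeta s) =
      1 / (s - 1) - (deriv riemannZeta s / riemannZeta s + 1 / (s - 1)) := by ring
  rw [h2, Complex.sub_re]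
  have := (Complex.abs_re_le_norm (deriv riemannZeta s / riemannZeta s + 1 / (s - 1))).trans h1
  linarith [neg_abs_le (deriv riemannZeta s / riemannZeta s + 1 / (s - 1)).re]

/-- `Re (1/(d + iu)) = d/(d² + u²)`. [folklore] -/
theorem re_inv_ofReal_add_mul_I (d u : ℝ) :
    ((d + u * I : ℂ)⁻¹).re = d / (d ^ 2 + u ^ 2) := by
  rw [Complex.inv_re]
  have hns : Complex.normSq (d + u * I) = d ^ 2 + u ^ 2 := by
    rw [Complex.normSq_apply]; simp; ring
  rw [hns]; simp

/-- `L(Λ, σ) = −ζ'/ζ(σ)` for real `σ > 1`, as real parts (Mathlib). [folklore] -/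
theorem LSeries_vonMangoldt_re_eq {σ : ℝ} (hσ : 1 < σ) :
    (L ↗Λ (σ : ℂ)).re = (-(deriv riemannZeta σ / riemannZeta σ)).re := by
  rw [ArithmeticFunction.LSeries_vonMangoldt_eq_deriv_riemannZeta_div (by simp [hσ]), neg_div]

end Literature.NumberTheory.LFunctions.DirichletZFR
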